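import Summits.QuantumAdvantage.QuantumAdvantage.Theses.WildDial
import Summits.QuantumAdvantage.QuantumAdvantage.Theorems.WildDialDoll

/-!
# WildDial — `CanonCoin3` (stmt-QuantumAdvantage-29657) holds

lens-1 g5 «WildDial» DOLL METHOD (critic rows 30–30v3; Theorems twin `WildDialDoll`, landed in four modules): for every
constant `d`, for all `n ≥ 12d + 6`, no `𝔽₃`-degree-`d` wild event `P₀` at position `0` completes the canonical affine base
(`canonStrat 0 w`: the canonical guess everywhere, flipped at position `1`, free bit `w` at position `0`) to a strategy
perfect on the odd class — `WildDialDoll.canonCoin3`.  The route item inlines `canonStrat`; the junction is definitional.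

Cell decomp-qadv (D-0178/D-0179), census seat decomp-qadv-census-1 g6 (prover lane); mathematics: lens-1 g5.
-/

set_option linter.dupNamespace false -- D-0017: single-problem summit ⇒ `QuantumAdvantage.QuantumAdvantage` by design

namespace Summit.QuantumAdvantage.QuantumAdvantage.Theorems

/-- **`WildDial.CanonCoin3` holds** (aside stmt-QuantumAdvantage-29657): for every `d` there is `n₀` (`= 12d + 6`) such that
for all `n ≥ n₀`, every degree-`≤ d` event `P₀` leaves an odd-class input on which the canonical one-wild strategy loses. -/
theorem wildDial_canonCoin3 : Summit.QuantumAdvantage.QuantumAdvantage.Theses.WildDial.CanonCoin3 := by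
  intro d
  obtain ⟨n₀, h⟩ := WildDialDoll.canonCoin3 d
  exact ⟨n₀, fun n hn h3 P₀ hP => h n hn h3 P₀ hP⟩

end Summit.QuantumAdvantage.QuantumAdvantage.Theorems
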